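import Summits.QuantumFields.BalabanUV.T4Continuum.Support.B13StepEndOn
import Summits.QuantumFields.BalabanUV.T4Continuum.Support.OutputRateTermwiseLocStructural

/-!
# NE5 ∕ U3 — THE R21 (2.14)-FACE APPLIED ON THE R20 CARRIER: the owner's most-reduced Cauchy face for (2.14)-shaped terms with
# PER-DOMAIN budgets (`OutputRateTermwiseLocStructural.ne5_at_of_stepModel_termwiseLoc_gaussianParamBi_mass_scale_nat`, END of
# record for (2.14)-shaped terms with absolute labels, ruling R21) applied BY NAME to the assembled step model over an arbitrary
# operator carrier `Op`, to the carriers OF RECORD over `Op`, and to the record's SUB-SLOT `M ≤ OpDatum E` (of record `↥measOp`, R20)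
# — MI-R, L03, the structure binders AND `TermRep` (d3-ii, from the per-domain majorant) DISCHARGED; conclusion literally `T4OutputRate.NE5 …`
# (typer `t4/formal/NE5/DAG.md`: END face E1[B13] = this lineage's `B13StepEnd`; sibling of `B13StepEndOn`)

Cell `pub-balaban`, unit `b2b-balaban-t4-ne5-formalise-leaf-09` (NE5 formalisation swarm, LEAF PROVER 09, gen 2; row O1-e holder).
Summits-side new work under the LEAN PLACEMENT RULE (cell bookkeeping; NOT a Literature module; NO landed module is edited — a NEW module
applying landed END faces BY NAME).  HONEST FRAMING: rung (B)+1 of the FINITE-VOLUME T⁴ continuum programme — NOT infinite volume, NOT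
a mass gap, NOT the Clay problem, and **NOT A PROOF OF NE5** (NOT PRINTED in [Balaban1987RG1]–[Balaban1989LargeFieldII]; cell GAPS
G-t4-U3-1): every theorem below is an IMPLICATION whose wall binders are DISPLAYED HYPOTHESES, asserted nowhere — in particular the ONE
(2.14)-shape `TermGaussianParamBi` of the term family (the dictionary: parameter spaces, Cauchy weight, holomorphic normalisation,
potential-free factor, history read-out, exponent with an AFFINE margin on the operator ball — [analysis], its LETTERS' values for
Bałaban's cores NOT PRINTED; base point of the margin = the decoupled operators σ(Z) = 0, [Balaban1988RG2Cluster] (2.15) p. 15 — KIND),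
the per-domain Gaussian MASS budget and the per-domain summability `TermBudgetLoc a G` (printed KIND: the summation to (2.41) p. 21 AT each
domain `X`), W1 (row NE2's entry currency or margin units), W4, the one-run slice budgets (W3-KIND), the levels L05∕L06 ([Balaban1987RG1]
(1.18) p. 263 — SHAPES), the numerics.  HONEST DEPENDENCY (cell line, verbatim): continuum YM on T⁴ ⇐ BetaPertH ∧ nine spine estimates
(0/9 proved); BetaPertH ⇐ (D1) ∧ (D4) ∧ CAP+tail; G-an2-4 gates asym, D1 and NE2/3/4.

WHY.  The owner's R21 face is generic in the step model `M` and the term family `T` and displays `hrA`∕`hrB` (MI-R), `hbase`∕`hbudget`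
(L03 + `BaseBudget`), `hrep : TermRep M (ballClass ctr ROp RHist) T W` and the insertion structure.  On the assembled model these are
THEOREMS of rows O1-c∕O1-e∕O1-f∕O1-d (`B13RepresentsOn` by name; `TermRep` from the per-domain majorant through leaf-04's X-dependent
comparison test `TermRepOfSeries.termRep_of_outIsSeriesOn_boundAt` and `AssemblyOn.outIsSeries` — the sibling module `B13StepEndOn` §1).
What this file leaves displayed is exactly what leaf-08's O1-d2-ii chain (the (2.14) cores of record as `TermGaussianParamBi` data on
`Op := ↥measOp`, R18; at TERM level from FACTOR cores: its `termGaussianParamBi_term_of_factors`) has to exhibit: `hBi`, the mass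
letters, `TermBudgetLoc`, plus the row-external walls.

WHAT THIS FILE DOES (compositions BY NAME; no estimate of its own; 0 def).
* §1 `ne5_of_assemblyOn_gaussianParamBi_mass_opRate` ∕ `…_reading` — the R21 face on `𝔄.stepOn (𝔄.bHist E₀ cB)` with `T := term 𝔄.𝒯 𝔄.inc
  𝔄.act`, `ctr := selfCtr raw histRef`, `BOp := 0`, `BHist := bHist E₀ cB`; `TermRep` by the sibling's `B13StepEndOn.termRep_stepOn_of_
  termBoundLoc` on `termBoundLoc_of_bi`; W1 as `OperatorRate δ θ` ∕ from the entry currency along `rd`.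
* §2 `ne5_of_recordOn_gaussianParamBi_mass_opRate` — §1 on Bałaban's paired-torus carriers OF RECORD over `Op` (`B13StepOfRecordSub.stepOn`);
  binder order = `B13StepEndInsOp.ne5_of_record_insOp`'s where the shapes coincide (owner R27 (iii)).
* §3 `ne5_of_record_onSub_gaussianParamBi_mass` — on the sub-slot `onSub S₀ M hA hB act` (cores on `↥M`; W1 PRODUCED from the record's
  entry currency; reading ∕ slice budgets ∕ W4 stated ON THE MODEL OF RECORD); `ne5_of_record_restrict_gaussianParamBi_mass` — cores of
  record through the inclusion, conclusion LITERALLY `NE5 (B13StepOfRecord.outA S₀ E₀ cB) (B13StepOfRecord.outB S₀ E₀ cB) W κ θ′ C₅`.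
  Slot of record: `M := measOp …` — spell it `onSub S₀ (measOp T κ ι Ω 𝒴) hA hB act` (see `B13StepEndOn`'s note on `onMeasOp`).
SAME smallness `ω + G·cA∕(1 − ρ₀) < θ′` and SAME constant as every termwise face.  0 sorry; no new axioms.
-/

noncomputable section

open Metric Set MeasureTheory

namespace Summit.QuantumFields.BalabanUV.T4Continuum.B13StepEndLoc

open Literature.MathematicalPhysics.QuantumFieldTheory.Balaban1983to89
open Literature.MathematicalPhysics.QuantumFieldTheory.Balaban1983to89.T4OutputRate (Carriers Functional DecayBound NE5)
open Literature.MathematicalPhysics.QuantumFieldTheory.Balaban1983to89.T4InputCauchyRateData (StepModel)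
open Literature.MathematicalPhysics.QuantumFieldTheory.Balaban1983to89.T4InputCauchyRateSpecies (ballClass)
open Summit.QuantumFields.BalabanUV.T4Continuum.B13Carriers (TwoRuns)
open Summit.QuantumFields.BalabanUV.T4Continuum.B13OpDatum (Format OpDatum)
open Summit.QuantumFields.BalabanUV.T4Continuum.B13OpDatumJunctions (opOf RawBounded WeightedEntrywiseRate)
open Summit.QuantumFields.BalabanUV.T4Continuum.B13StepTermLabels (TermIdx InnerLabel)
open Summit.QuantumFields.BalabanUV.T4Continuum.B13StepTermFamily (term)
open Summit.QuantumFields.BalabanUV.T4Continuum.B13InnerData (Bnd)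
open Summit.QuantumFields.BalabanUV.T4Continuum.B13Base (selfCtr)
open Summit.QuantumFields.BalabanUV.T4Continuum.B13RepresentsOn (AssemblyOn)
open Summit.QuantumFields.BalabanUV.T4Continuum.B13StepOfRecord (Slots assembly step)
open Summit.QuantumFields.BalabanUV.T4Continuum.B13StepOfRecordSub
  (SlotsOn assemblyOn stepOn outA outB onSub restrict transportReads_onSub_iff sliceBudgetB_onSub_iff
    sliceBudget_onSub_iff insertionRate_onSub_iff operatorRate_onSub_of_weightedEntrywise outA_restrict outB_restrict)
open Summit.QuantumFields.BalabanUV.T4Continuum.B13StepEndOn (termRep_stepOn_of_termBoundLoc)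
open Summit.QuantumFields.BalabanUV.T4Continuum.OutputRateOpGaussianParam (paramMass)
open Summit.QuantumFields.BalabanUV.T4Continuum.OutputRateGaussianParamBi (TermGaussianParamBi)
open Summit.QuantumFields.BalabanUV.T4Continuum.OutputRateTermwiseLoc (TermBudgetLoc)
open Summit.QuantumFields.BalabanUV.T4Continuum.OutputRateTermwiseLocStructural
  (termBoundLoc_of_bi ne5_at_of_stepModel_termwiseLoc_gaussianParamBi_mass_scale_nat)

/-! ## §1 The R21 (2.14)-face on the assembled step model over an arbitrary operator carrier `Op` -/

section OverOp

variable {C : Carriers} {Op IOp Hist ι P J : Type*} [NormedAddCommGroup Op] [NormedSpace ℂ Op] [NormedAddCommGroup Hist]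
  [NormedSpace ℂ Hist] (𝔄 : AssemblyOn C Op IOp Hist ι P J)
  {β : ℕ → ι → Type*} [∀ k i, MeasurableSpace (β k i)]
  (α : ℕ → ι → Type*) [∀ k i, NormedAddCommGroup (α k i)] [∀ k i, InnerProductSpace ℝ (α k i)]
  [∀ k i, FiniteDimensional ℝ (α k i)] [∀ k i, MeasurableSpace (α k i)] [∀ k i, BorelSpace (α k i)]

/-- [folklore] **THE (2.14)-FACE ON THE ASSEMBLED STEP MODEL OVER `Op`, W1 IN MARGIN UNITS.**  For `𝔄.stepOn (𝔄.bHist E₀ cB)` with its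
recursively defined outputs `outA`∕`outB` and the term family `term 𝔄.𝒯 𝔄.inc 𝔄.act` on the roomy class `ballClass (selfCtr raw histRef) ROp
RHist` (operator radius `rOp ≤ ROp < R′`, history radius `bHist E₀ cB + rHist ≤ RHist`): the transport READING; the two one-run slice
budgets (W3-KIND); the levels `DecayBound outA W EA₀ κ` ∕ `DecayBound outB W E₀ κ` (L05∕L06 SHAPES); `OperatorRate δ θ` (W1) and
`InsertionRate δ′` (W4); the per-domain summability `TermBudgetLoc a G`; **the ONE (2.14)-shape `TermGaussianParamBi (term …) W (selfCtr …)
RHist R′ lam w N F₀ Λ q m b w₀ N₀ F N₁`** and **the per-domain Gaussian MASS budget** `paramMass … k i h X ≤ a k i X·e^{−κd X}` (the owner's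
binder VERBATIM) for `h` in the history ball; the numerics — IMPLY `NE5 outA outB W κ θ′ C₅` with the termwise faces' constant.
DISCHARGED inside: MI-R
(`representsA hT`∕`representsB`), L03 (`inBase`) + `BaseBudget` (`baseBudget`), `TermRep` (the sibling's `termRep_stepOn_of_termBoundLoc`
on `termBoundLoc_of_bi`), the structure binders and `InsScaleBound` (row O1-c by construction).  The face applied is
`OutputRateTermwiseLocStructural.ne5_at_of_stepModel_termwiseLoc_gaussianParamBi_mass_scale_nat`, BY NAME.  NOT a proof of NE5: no
binder is instantiated on Bałaban's objects here. -/
theorem ne5_of_assemblyOn_gaussianParamBi_mass_opRate {W : Set (ℕ → ℝ)} {ROp RHist R' : ℕ → ℝ} {a : ℕ → ι → C.Dom → ℝ}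
    {lam : ∀ k i, C.Dom → Measure (β k i)} {w : ∀ k i, C.Dom → β k i → ℂ} {N : ∀ k i, C.Dom → Op → β k i → ℂ}
    {F₀ : ∀ k i, C.Dom → β k i → α k i → ℂ} {Λ : ∀ k i, C.Dom → β k i → α k i → (Hist →L[ℂ] ℂ)}
    {q : ∀ k i, C.Dom → Op → β k i → α k i → ℂ} {m b w₀ N₀ F N₁ : ℕ → ι → C.Dom → ℝ}
    {κ G EA₀ E₀ E₁ cA cB δ δ' θ θ' ρ₀ B : ℝ} {k₀ : ℕ}
    (hT : 𝔄.TransportReads W)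
    (hbB : 𝔄.SliceBudgetB W κ cB) (hbA : 𝔄.D.SliceBudget (𝔄.stepOn (𝔄.bHist E₀ cB)) W κ cA)
    (hdA : DecayBound (𝔄.outA (𝔄.bHist E₀ cB)) W EA₀ κ) (hdB : DecayBound (𝔄.outB (𝔄.bHist E₀ cB)) W E₀ κ)
    (hop : (𝔄.stepOn (𝔄.bHist E₀ cB)).OperatorRate W δ θ) (hins : (𝔄.stepOn (𝔄.bHist E₀ cB)).InsertionRate W κ E₀ δ' θ)
    (hbud : TermBudgetLoc a G) (hOp : ∀ k, 𝔄.rOp k ≤ ROp k) (hroom : ∀ k, ROp k < R' k)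
    (hHist : ∀ k, 𝔄.bHist E₀ cB k + 𝔄.rHist k ≤ RHist k)
    (hBi : TermGaussianParamBi (term 𝔄.𝒯 𝔄.inc 𝔄.act) W (selfCtr 𝔄.raw 𝔄.histRef) RHist R' lam w N F₀ Λ q m b w₀ N₀ F N₁)
    (hmass : ∀ k, ∀ g ∈ W, ∀ (U : C.BgB), ∀ h ∈ closedBall (selfCtr 𝔄.raw 𝔄.histRef k g U).2 (RHist k), ∀ X : C.Dom, C.scale X = k → ∀ i,
      paramMass α (fun k i (_ : Hist) X => lam k i X) (fun k i (_ : Hist) X => m k i X) (fun k i (_ : Hist) X => b k i X)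
        (fun k i (_ : Hist) X => w₀ k i X) (fun k i (_ : Hist) X => N₀ k i X)
        (fun k i h X => F k i X * Real.exp (N₁ k i X * ‖h‖)) k i h X ≤ a k i X * Real.exp (-(κ * C.d X)))
    (hE₀ : 0 ≤ E₀) (hE₁ : 0 < E₁) (hG : 0 ≤ G) (hcA : 0 ≤ cA) (hcB : 0 ≤ cB) (hδ : 0 ≤ δ) (hδ' : 0 ≤ δ')
    (hθ : 0 ≤ θ) (hθθ' : θ ≤ θ') (hθ'1 : θ' ≤ 1) (hω : 0 < 𝔄.D.ω) (hω1 : 𝔄.D.ω < 1) (hρ₀ : ρ₀ < 1)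
    (hnear : (δ + δ') * θ ^ k₀ + cA * (EA₀ + E₀) / (1 - 𝔄.D.ω) ≤ ρ₀) (hB : 0 ≤ B)
    (hfirst : ∀ k < k₀, EA₀ + E₀ ≤ B * θ ^ k) (hsmall : 𝔄.D.ω + G / (1 - ρ₀) * cA < θ') :
    NE5 (𝔄.outA (𝔄.bHist E₀ cB)) (𝔄.outB (𝔄.bHist E₀ cB)) W κ θ'
      ((G / (1 - ρ₀) * δ + G / (1 - ρ₀) * δ' + B) * (θ' - 𝔄.D.ω) / (θ' - (𝔄.D.ω + G / (1 - ρ₀) * cA))) :=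
  have hOp' : ∀ k, (0 : ℕ → ℝ) k + (𝔄.stepOn (𝔄.bHist E₀ cB)).rOp k ≤ ROp k := fun k => by
    rw [Pi.zero_apply, zero_add]; exact hOp k
  ne5_at_of_stepModel_termwiseLoc_gaussianParamBi_mass_scale_nat (𝔄.stepOn (𝔄.bHist E₀ cB)) (term 𝔄.𝒯 𝔄.inc 𝔄.act)
    (𝔄.representsA _ hT) (𝔄.representsB _ W) (AssemblyOn.inBase hbB hdB hE₀ hcB hω.le hω1) (𝔄.baseBudget _ W) hOp' hHist
    (termRep_stepOn_of_termBoundLoc (termBoundLoc_of_bi hroom hBi hmass) fun k X hX => (hbud k X hX).1) hbud hroom hBi hmass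
    hdA hdB hop hins (𝔄.insAffine _ W) (𝔄.insBlind _ W) (𝔄.insHomog _ W) (AssemblyOn.insScaleBound hbA hω.le hE₁.le) hE₁ hG hδ
    hδ' hθ hθθ' hθ'1 hcA hω hρ₀ hnear hB hfirst hsmall

/-- [folklore] **THE (2.14)-FACE ON THE ASSEMBLED STEP MODEL OVER `Op`, W1 FROM ROW NE2's ENTRY CURRENCY ALONG A READING** (R20): as
`ne5_of_assemblyOn_gaussianParamBi_mass_opRate` with `hop` PRODUCED by `AssemblyOn.operatorRate_of_reading` from a reading
`rd : Op →L[ℂ] OpDatum E` that does not contract norms and returns row O1-b's `opOf F rawA` ∕ `opOf F rawB`, bounded raw suppliers, row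
NE2's weighted entrywise two-run rate `c₁·θ^k` at the transported background (DISPLAYED, NOT PRINTED) and the margin floor `r₀`
(`δ := c₁∕r₀`). -/
theorem ne5_of_assemblyOn_gaussianParamBi_mass_reading {E : Type*} (rd : Op →L[ℂ] OpDatum E) (hrd : ∀ z : Op, ‖z‖ ≤ ‖rd z‖)
    {Fm : ℕ → Format E} {rawA : (ℕ → ℝ) → C.BgA → ℕ → E → ℂ} {rawB : (ℕ → ℝ) → C.BgB → ℕ → E → ℂ}
    (hrdA : ∀ g V k, rd (𝔄.opA g V k) = opOf Fm rawA g V k) (hrdB : ∀ g U k, rd (𝔄.opB g U k) = opOf Fm rawB g U k)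
    {W : Set (ℕ → ℝ)} {ROp RHist R' : ℕ → ℝ} {a : ℕ → ι → C.Dom → ℝ}
    {lam : ∀ k i, C.Dom → Measure (β k i)} {w : ∀ k i, C.Dom → β k i → ℂ} {N : ∀ k i, C.Dom → Op → β k i → ℂ}
    {F₀ : ∀ k i, C.Dom → β k i → α k i → ℂ} {Λ : ∀ k i, C.Dom → β k i → α k i → (Hist →L[ℂ] ℂ)}
    {q : ∀ k i, C.Dom → Op → β k i → α k i → ℂ} {m b w₀ N₀ F N₁ : ℕ → ι → C.Dom → ℝ}
    {κ G EA₀ E₀ E₁ cA cB c₁ r₀ δ' θ θ' ρ₀ B : ℝ} {k₀ : ℕ}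
    (hT : 𝔄.TransportReads W)
    (hbB : 𝔄.SliceBudgetB W κ cB) (hbA : 𝔄.D.SliceBudget (𝔄.stepOn (𝔄.bHist E₀ cB)) W κ cA)
    (hdA : DecayBound (𝔄.outA (𝔄.bHist E₀ cB)) W EA₀ κ) (hdB : DecayBound (𝔄.outB (𝔄.bHist E₀ cB)) W E₀ κ)
    (hRA : RawBounded Fm (fun g U k => rawA g (C.transport U) k) W) (hRB : RawBounded Fm rawB W)
    (hwer : WeightedEntrywiseRate Fm (fun g U k => rawA g (C.transport U) k) rawB W c₁ fun k => θ ^ k)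
    (hfl : ∀ k, r₀ ≤ 𝔄.rOp k) (hins : (𝔄.stepOn (𝔄.bHist E₀ cB)).InsertionRate W κ E₀ δ' θ)
    (hbud : TermBudgetLoc a G) (hOp : ∀ k, 𝔄.rOp k ≤ ROp k) (hroom : ∀ k, ROp k < R' k)
    (hHist : ∀ k, 𝔄.bHist E₀ cB k + 𝔄.rHist k ≤ RHist k)
    (hBi : TermGaussianParamBi (term 𝔄.𝒯 𝔄.inc 𝔄.act) W (selfCtr 𝔄.raw 𝔄.histRef) RHist R' lam w N F₀ Λ q m b w₀ N₀ F N₁)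
    (hmass : ∀ k, ∀ g ∈ W, ∀ (U : C.BgB), ∀ h ∈ closedBall (selfCtr 𝔄.raw 𝔄.histRef k g U).2 (RHist k), ∀ X : C.Dom, C.scale X = k → ∀ i,
      paramMass α (fun k i (_ : Hist) X => lam k i X) (fun k i (_ : Hist) X => m k i X) (fun k i (_ : Hist) X => b k i X)
        (fun k i (_ : Hist) X => w₀ k i X) (fun k i (_ : Hist) X => N₀ k i X)
        (fun k i h X => F k i X * Real.exp (N₁ k i X * ‖h‖)) k i h X ≤ a k i X * Real.exp (-(κ * C.d X)))
    (hE₀ : 0 ≤ E₀) (hE₁ : 0 < E₁) (hG : 0 ≤ G) (hcA : 0 ≤ cA) (hcB : 0 ≤ cB) (hc₁ : 0 ≤ c₁) (hr₀ : 0 < r₀) (hδ' : 0 ≤ δ')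
    (hθ : 0 ≤ θ) (hθθ' : θ ≤ θ') (hθ'1 : θ' ≤ 1) (hω : 0 < 𝔄.D.ω) (hω1 : 𝔄.D.ω < 1) (hρ₀ : ρ₀ < 1)
    (hnear : (c₁ / r₀ + δ') * θ ^ k₀ + cA * (EA₀ + E₀) / (1 - 𝔄.D.ω) ≤ ρ₀) (hB : 0 ≤ B)
    (hfirst : ∀ k < k₀, EA₀ + E₀ ≤ B * θ ^ k) (hsmall : 𝔄.D.ω + G / (1 - ρ₀) * cA < θ') :
    NE5 (𝔄.outA (𝔄.bHist E₀ cB)) (𝔄.outB (𝔄.bHist E₀ cB)) W κ θ'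
      ((G / (1 - ρ₀) * (c₁ / r₀) + G / (1 - ρ₀) * δ' + B) * (θ' - 𝔄.D.ω) / (θ' - (𝔄.D.ω + G / (1 - ρ₀) * cA))) :=
  ne5_of_assemblyOn_gaussianParamBi_mass_opRate 𝔄 α hT hbB hbA hdA hdB
    (AssemblyOn.operatorRate_of_reading rd hrd hrdA hrdB hRA hRB hwer hc₁ hθ hfl hr₀) hins hbud hOp hroom hHist hBi hmass hE₀ hE₁
    hG hcA hcB (div_nonneg hc₁ hr₀.le) hδ' hθ hθθ' hθ'1 hω hω1 hρ₀ hnear hB hfirst hsmall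

end OverOp

/-! ## §2 The R21 (2.14)-face on the carriers OF RECORD over `Op` -/

section RecordOn

variable {G : Type} [GaugeGroup G] {R : TwoRuns G} {Op IOp Hist : Type*} [NormedAddCommGroup Op] [NormedSpace ℂ Op]
  [NormedAddCommGroup Hist] [NormedSpace ℂ Hist] (S : SlotsOn R Op IOp Hist) (E₀ cB : ℝ)
  {β : ℕ → TermIdx R.carriers.Dom (Bnd R) → Type*} [∀ k i, MeasurableSpace (β k i)]
  (α : ℕ → TermIdx R.carriers.Dom (Bnd R) → Type*) [∀ k i, NormedAddCommGroup (α k i)] [∀ k i, InnerProductSpace ℝ (α k i)]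
  [∀ k i, FiniteDimensional ℝ (α k i)] [∀ k i, MeasurableSpace (α k i)] [∀ k i, BorelSpace (α k i)]

/-- [folklore] **THE (2.14)-FACE ON THE CARRIERS OF RECORD OVER `Op`** (`B13StepOfRecordSub.stepOn S E₀ cB` on `B13Carriers.TwoRuns.carriers
R`, indexing `labelsIndexing …` ∕ hard core `touchInc …` OF RECORD, ABSOLUTE term labels `TermIdx` — the per-domain budget is the form
instantiable for them, R21): conclusion LITERALLY `T4OutputRate.NE5 (outA S E₀ cB) (outB S E₀ cB) W κ θ′ C₅`; W1 in margin units; the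
analytic slots `S`, the shape's data and every letter are PARAMETERS ∕ displayed (nothing of [II]'s cores is identified here). -/
theorem ne5_of_recordOn_gaussianParamBi_mass_opRate {W : Set (ℕ → ℝ)} {ROp RHist R' : ℕ → ℝ}
    {a : ℕ → TermIdx R.carriers.Dom (Bnd R) → R.carriers.Dom → ℝ}
    {lam : ∀ k i, R.carriers.Dom → Measure (β k i)} {w : ∀ k i, R.carriers.Dom → β k i → ℂ}
    {N : ∀ k i, R.carriers.Dom → Op → β k i → ℂ} {F₀ : ∀ k i, R.carriers.Dom → β k i → α k i → ℂ}
    {Λ : ∀ k i, R.carriers.Dom → β k i → α k i → (Hist →L[ℂ] ℂ)} {q : ∀ k i, R.carriers.Dom → Op → β k i → α k i → ℂ}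
    {m b w₀ N₀ F N₁ : ℕ → TermIdx R.carriers.Dom (Bnd R) → R.carriers.Dom → ℝ}
    {κ G EA₀ E₁ cA δ δ' θ θ' ρ₀ B : ℝ} {k₀ : ℕ}
    (hT : (assemblyOn S).TransportReads W)
    (hbB : (assemblyOn S).SliceBudgetB W κ cB) (hbA : S.D.SliceBudget (stepOn S E₀ cB) W κ cA)
    (hdA : DecayBound (outA S E₀ cB) W EA₀ κ) (hdB : DecayBound (outB S E₀ cB) W E₀ κ)
    (hop : (stepOn S E₀ cB).OperatorRate W δ θ) (hins : (stepOn S E₀ cB).InsertionRate W κ E₀ δ' θ)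
    (hbud : TermBudgetLoc a G) (hOp : ∀ k, S.rOp k ≤ ROp k) (hroom : ∀ k, ROp k < R' k)
    (hHist : ∀ k, (assemblyOn S).bHist E₀ cB k + S.rHist k ≤ RHist k)
    (hBi : TermGaussianParamBi (term (assemblyOn S).𝒯 (assemblyOn S).inc S.act) W
      (selfCtr (assemblyOn S).raw (assemblyOn S).histRef) RHist R' lam w N F₀ Λ q m b w₀ N₀ F N₁)
    (hmass : ∀ k, ∀ g ∈ W, ∀ (U : R.carriers.BgB), ∀ h ∈ closedBall (selfCtr (assemblyOn S).raw (assemblyOn S).histRef k g U).2 (RHist k),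
      ∀ X : R.carriers.Dom, R.carriers.scale X = k → ∀ i,
      paramMass α (fun k i (_ : Hist) X => lam k i X) (fun k i (_ : Hist) X => m k i X) (fun k i (_ : Hist) X => b k i X)
        (fun k i (_ : Hist) X => w₀ k i X) (fun k i (_ : Hist) X => N₀ k i X)
        (fun k i h X => F k i X * Real.exp (N₁ k i X * ‖h‖)) k i h X ≤ a k i X * Real.exp (-(κ * R.carriers.d X)))
    (hE₀ : 0 ≤ E₀) (hE₁ : 0 < E₁) (hG : 0 ≤ G) (hcA : 0 ≤ cA) (hcB : 0 ≤ cB) (hδ : 0 ≤ δ) (hδ' : 0 ≤ δ')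
    (hθ : 0 ≤ θ) (hθθ' : θ ≤ θ') (hθ'1 : θ' ≤ 1) (hω : 0 < S.D.ω) (hω1 : S.D.ω < 1) (hρ₀ : ρ₀ < 1)
    (hnear : (δ + δ') * θ ^ k₀ + cA * (EA₀ + E₀) / (1 - S.D.ω) ≤ ρ₀) (hB : 0 ≤ B)
    (hfirst : ∀ k < k₀, EA₀ + E₀ ≤ B * θ ^ k) (hsmall : S.D.ω + G / (1 - ρ₀) * cA < θ') :
    NE5 (outA S E₀ cB) (outB S E₀ cB) W κ θ'
      ((G / (1 - ρ₀) * δ + G / (1 - ρ₀) * δ' + B) * (θ' - S.D.ω) / (θ' - (S.D.ω + G / (1 - ρ₀) * cA))) :=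
  ne5_of_assemblyOn_gaussianParamBi_mass_opRate (assemblyOn S) α hT hbB hbA hdA hdB hop hins hbud hOp hroom hHist hBi hmass hE₀ hE₁
    hG hcA hcB hδ hδ' hθ hθθ' hθ'1 hω hω1 hρ₀ hnear hB hfirst hsmall

end RecordOn

/-! ## §3 The R21 (2.14)-face on the SUB-SLOT `M ≤ OpDatum E` holding the operator data of record (of record `↥measOp`, R20) -/

section OnSub

variable {G : Type} [GaugeGroup G] {R : TwoRuns G} {E IOp Hist : Type*} [NormedAddCommGroup Hist] [NormedSpace ℂ Hist]
  (S₀ : Slots R E IOp Hist) (M : Submodule ℂ (OpDatum E))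
  (hMA : ∀ g V k, opOf S₀.F S₀.rawA g V k ∈ M) (hMB : ∀ g U k, opOf S₀.F S₀.rawB g U k ∈ M)
  (act : R.carriers.Dom → InnerLabel R.carriers.Dom (Bnd R) → M → Hist → ℂ) (E₀ cB : ℝ)
  {β : ℕ → TermIdx R.carriers.Dom (Bnd R) → Type*} [∀ k i, MeasurableSpace (β k i)]
  (α : ℕ → TermIdx R.carriers.Dom (Bnd R) → Type*) [∀ k i, NormedAddCommGroup (α k i)] [∀ k i, InnerProductSpace ℝ (α k i)]
  [∀ k i, FiniteDimensional ℝ (α k i)] [∀ k i, MeasurableSpace (α k i)] [∀ k i, BorelSpace (α k i)]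

/-- [folklore] **THE (2.14)-FACE ON THE SUB-SLOT, CORES TYPED ON `↥M`** (`B13StepOfRecordSub.stepOn (onSub S₀ M hA hB act) E₀ cB :
StepModel R.carriers ↥M Hist` — the operator ball of the shape's holomorphy ∕ margin clauses is a ball of `↥M`: complex operator
directions IN `M` only, the form in which they are satisfiable for `x`-indexed cores, R20 ∕ G-ne5p2-5).  DISPLAYED ON THE MODEL OF
RECORD `B13StepOfRecord.step S₀ E₀ cB` (transferred inside by `Iff.rfl`): the transport reading, the two one-run slice budgets, W4; W1
PRODUCED from the record's bounded raw suppliers + row NE2's weighted entrywise two-run rate `c₁·θ^k` + the margin floor `r₀`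
(`operatorRate_onSub_of_weightedEntrywise`); DISPLAYED ON THE SUB-SLOT MODEL: the levels of ITS outputs, the ONE shape `hBi` of the term
family of the cores `act` about the self-centred centre, the per-domain mass letters and `TermBudgetLoc`; room; numerics.  Conclusion
LITERALLY `T4OutputRate.NE5 (outA (onSub S₀ M hA hB act) E₀ cB) (outB (onSub S₀ M hA hB act) E₀ cB) W κ θ′ C₅`.  The slot OF RECORD is
`M := measOp T κ ι Ω 𝒴` with `hA`∕`hB` from `B13StepOfRecordSub.opA_mem_measOp`∕`opB_mem_measOp`. -/
theorem ne5_of_record_onSub_gaussianParamBi_mass {W : Set (ℕ → ℝ)} {ROp RHist R' : ℕ → ℝ}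
    {a : ℕ → TermIdx R.carriers.Dom (Bnd R) → R.carriers.Dom → ℝ}
    {lam : ∀ k i, R.carriers.Dom → Measure (β k i)} {w : ∀ k i, R.carriers.Dom → β k i → ℂ}
    {N : ∀ k i, R.carriers.Dom → M → β k i → ℂ} {F₀ : ∀ k i, R.carriers.Dom → β k i → α k i → ℂ}
    {Λ : ∀ k i, R.carriers.Dom → β k i → α k i → (Hist →L[ℂ] ℂ)} {q : ∀ k i, R.carriers.Dom → M → β k i → α k i → ℂ}
    {m b w₀ N₀ F N₁ : ℕ → TermIdx R.carriers.Dom (Bnd R) → R.carriers.Dom → ℝ}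
    {κ G EA₀ E₁ cA c₁ r₀ δ' θ θ' ρ₀ B : ℝ} {k₀ : ℕ}
    (hT : (assembly S₀).TransportReads W)
    (hbB : (assembly S₀).SliceBudgetB W κ cB) (hbA : S₀.D.SliceBudget (step S₀ E₀ cB) W κ cA)
    (hdA : DecayBound (outA (onSub S₀ M hMA hMB act) E₀ cB) W EA₀ κ)
    (hdB : DecayBound (outB (onSub S₀ M hMA hMB act) E₀ cB) W E₀ κ)
    (hRA : RawBounded S₀.F (assembly S₀).rawAt W) (hRB : RawBounded S₀.F S₀.rawB W)
    (hwer : WeightedEntrywiseRate S₀.F (assembly S₀).rawAt S₀.rawB W c₁ fun k => θ ^ k) (hfl : ∀ k, r₀ ≤ S₀.rOp k)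
    (hins : (step S₀ E₀ cB).InsertionRate W κ E₀ δ' θ)
    (hbud : TermBudgetLoc a G) (hOp : ∀ k, S₀.rOp k ≤ ROp k) (hroom : ∀ k, ROp k < R' k)
    (hHist : ∀ k, (assembly S₀).bHist E₀ cB k + S₀.rHist k ≤ RHist k)
    (hBi : TermGaussianParamBi (term (assemblyOn (onSub S₀ M hMA hMB act)).𝒯 (assemblyOn (onSub S₀ M hMA hMB act)).inc act) W
      (selfCtr (assemblyOn (onSub S₀ M hMA hMB act)).raw (assemblyOn (onSub S₀ M hMA hMB act)).histRef) RHist R' lam w N F₀ Λ q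
      m b w₀ N₀ F N₁)
    (hmass : ∀ k, ∀ g ∈ W, ∀ (U : R.carriers.BgB), ∀ h ∈ closedBall
      (selfCtr (assemblyOn (onSub S₀ M hMA hMB act)).raw (assemblyOn (onSub S₀ M hMA hMB act)).histRef k g U).2 (RHist k),
      ∀ X : R.carriers.Dom, R.carriers.scale X = k → ∀ i,
      paramMass α (fun k i (_ : Hist) X => lam k i X) (fun k i (_ : Hist) X => m k i X) (fun k i (_ : Hist) X => b k i X)
        (fun k i (_ : Hist) X => w₀ k i X) (fun k i (_ : Hist) X => N₀ k i X)
        (fun k i h X => F k i X * Real.exp (N₁ k i X * ‖h‖)) k i h X ≤ a k i X * Real.exp (-(κ * R.carriers.d X)))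
    (hE₀ : 0 ≤ E₀) (hE₁ : 0 < E₁) (hG : 0 ≤ G) (hcA : 0 ≤ cA) (hcB : 0 ≤ cB) (hc₁ : 0 ≤ c₁) (hr₀ : 0 < r₀) (hδ' : 0 ≤ δ')
    (hθ : 0 ≤ θ) (hθθ' : θ ≤ θ') (hθ'1 : θ' ≤ 1) (hω : 0 < S₀.D.ω) (hω1 : S₀.D.ω < 1) (hρ₀ : ρ₀ < 1)
    (hnear : (c₁ / r₀ + δ') * θ ^ k₀ + cA * (EA₀ + E₀) / (1 - S₀.D.ω) ≤ ρ₀) (hB : 0 ≤ B)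
    (hfirst : ∀ k < k₀, EA₀ + E₀ ≤ B * θ ^ k) (hsmall : S₀.D.ω + G / (1 - ρ₀) * cA < θ') :
    NE5 (outA (onSub S₀ M hMA hMB act) E₀ cB) (outB (onSub S₀ M hMA hMB act) E₀ cB) W κ θ'
      ((G / (1 - ρ₀) * (c₁ / r₀) + G / (1 - ρ₀) * δ' + B) * (θ' - S₀.D.ω) / (θ' - (S₀.D.ω + G / (1 - ρ₀) * cA))) :=
  ne5_of_recordOn_gaussianParamBi_mass_opRate (onSub S₀ M hMA hMB act) E₀ cB α ((transportReads_onSub_iff S₀ M hMA hMB act W).2 hT)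
    ((sliceBudgetB_onSub_iff S₀ M hMA hMB act W κ cB).2 hbB) ((sliceBudget_onSub_iff S₀ M hMA hMB act E₀ cB W κ cA).2 hbA) hdA hdB
    (operatorRate_onSub_of_weightedEntrywise S₀ M hMA hMB act E₀ cB hRA hRB hwer hc₁ hθ hfl hr₀)
    ((insertionRate_onSub_iff S₀ M hMA hMB act E₀ cB W κ E₀ δ' θ).2 hins) hbud hOp hroom hHist hBi hmass hE₀ hE₁ hG hcA hcB
    (div_nonneg hc₁ hr₀.le) hδ' hθ hθθ' hθ'1 hω hω1 hρ₀ hnear hB hfirst hsmall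

/-- [folklore] **THE (2.14)-FACE ON THE SUB-SLOT WITH THE CORES OF RECORD RESTRICTED TO `M`** (`B13StepOfRecordSub.restrict S₀ M hA hB`:
cores := `S₀.act` read through the inclusion `↥M → OpDatum E`).  Its outputs ARE the outputs of record (`outA_restrict`∕`outB_restrict`,
`rfl`), so the conclusion is LITERALLY `T4OutputRate.NE5 (B13StepOfRecord.outA S₀ E₀ cB) (B13StepOfRecord.outB S₀ E₀ cB) W κ θ′ C₅` — the
shape node U3's consumers read — while the ONE shape `hBi` is displayed for the restricted term family on the SUB-SLOT class (operator
ball in `↥M`).  Levels, reading, slice budgets, W4, W1's entry currency: all ON THE MODEL OF RECORD. -/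
theorem ne5_of_record_restrict_gaussianParamBi_mass {W : Set (ℕ → ℝ)} {ROp RHist R' : ℕ → ℝ}
    {a : ℕ → TermIdx R.carriers.Dom (Bnd R) → R.carriers.Dom → ℝ}
    {lam : ∀ k i, R.carriers.Dom → Measure (β k i)} {w : ∀ k i, R.carriers.Dom → β k i → ℂ}
    {N : ∀ k i, R.carriers.Dom → M → β k i → ℂ} {F₀ : ∀ k i, R.carriers.Dom → β k i → α k i → ℂ}
    {Λ : ∀ k i, R.carriers.Dom → β k i → α k i → (Hist →L[ℂ] ℂ)} {q : ∀ k i, R.carriers.Dom → M → β k i → α k i → ℂ}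
    {m b w₀ N₀ F N₁ : ℕ → TermIdx R.carriers.Dom (Bnd R) → R.carriers.Dom → ℝ}
    {κ G EA₀ E₁ cA c₁ r₀ δ' θ θ' ρ₀ B : ℝ} {k₀ : ℕ}
    (hT : (assembly S₀).TransportReads W)
    (hbB : (assembly S₀).SliceBudgetB W κ cB) (hbA : S₀.D.SliceBudget (step S₀ E₀ cB) W κ cA)
    (hdA : DecayBound (B13StepOfRecord.outA S₀ E₀ cB) W EA₀ κ) (hdB : DecayBound (B13StepOfRecord.outB S₀ E₀ cB) W E₀ κ)
    (hRA : RawBounded S₀.F (assembly S₀).rawAt W) (hRB : RawBounded S₀.F S₀.rawB W)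
    (hwer : WeightedEntrywiseRate S₀.F (assembly S₀).rawAt S₀.rawB W c₁ fun k => θ ^ k) (hfl : ∀ k, r₀ ≤ S₀.rOp k)
    (hins : (step S₀ E₀ cB).InsertionRate W κ E₀ δ' θ)
    (hbud : TermBudgetLoc a G) (hOp : ∀ k, S₀.rOp k ≤ ROp k) (hroom : ∀ k, ROp k < R' k)
    (hHist : ∀ k, (assembly S₀).bHist E₀ cB k + S₀.rHist k ≤ RHist k)
    (hBi : TermGaussianParamBi (term (assemblyOn (restrict S₀ M hMA hMB)).𝒯 (assemblyOn (restrict S₀ M hMA hMB)).inc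
      (restrict S₀ M hMA hMB).act) W (selfCtr (assemblyOn (restrict S₀ M hMA hMB)).raw (assemblyOn (restrict S₀ M hMA hMB)).histRef)
      RHist R' lam w N F₀ Λ q m b w₀ N₀ F N₁)
    (hmass : ∀ k, ∀ g ∈ W, ∀ (U : R.carriers.BgB), ∀ h ∈ closedBall
      (selfCtr (assemblyOn (restrict S₀ M hMA hMB)).raw (assemblyOn (restrict S₀ M hMA hMB)).histRef k g U).2 (RHist k),
      ∀ X : R.carriers.Dom, R.carriers.scale X = k → ∀ i,
      paramMass α (fun k i (_ : Hist) X => lam k i X) (fun k i (_ : Hist) X => m k i X) (fun k i (_ : Hist) X => b k i X)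
        (fun k i (_ : Hist) X => w₀ k i X) (fun k i (_ : Hist) X => N₀ k i X)
        (fun k i h X => F k i X * Real.exp (N₁ k i X * ‖h‖)) k i h X ≤ a k i X * Real.exp (-(κ * R.carriers.d X)))
    (hE₀ : 0 ≤ E₀) (hE₁ : 0 < E₁) (hG : 0 ≤ G) (hcA : 0 ≤ cA) (hcB : 0 ≤ cB) (hc₁ : 0 ≤ c₁) (hr₀ : 0 < r₀) (hδ' : 0 ≤ δ')
    (hθ : 0 ≤ θ) (hθθ' : θ ≤ θ') (hθ'1 : θ' ≤ 1) (hω : 0 < S₀.D.ω) (hω1 : S₀.D.ω < 1) (hρ₀ : ρ₀ < 1)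
    (hnear : (c₁ / r₀ + δ') * θ ^ k₀ + cA * (EA₀ + E₀) / (1 - S₀.D.ω) ≤ ρ₀) (hB : 0 ≤ B)
    (hfirst : ∀ k < k₀, EA₀ + E₀ ≤ B * θ ^ k) (hsmall : S₀.D.ω + G / (1 - ρ₀) * cA < θ') :
    NE5 (B13StepOfRecord.outA S₀ E₀ cB) (B13StepOfRecord.outB S₀ E₀ cB) W κ θ'
      ((G / (1 - ρ₀) * (c₁ / r₀) + G / (1 - ρ₀) * δ' + B) * (θ' - S₀.D.ω) / (θ' - (S₀.D.ω + G / (1 - ρ₀) * cA))) := by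
  have hdA' : DecayBound (outA (restrict S₀ M hMA hMB) E₀ cB) W EA₀ κ := by rwa [outA_restrict]
  have hdB' : DecayBound (outB (restrict S₀ M hMA hMB) E₀ cB) W E₀ κ := by rwa [outB_restrict]
  have h := ne5_of_record_onSub_gaussianParamBi_mass S₀ M hMA hMB _ E₀ cB α hT hbB hbA hdA' hdB' hRA hRB hwer hfl hins hbud hOp
    hroom hHist hBi hmass hE₀ hE₁ hG hcA hcB hc₁ hr₀ hδ' hθ hθθ' hθ'1 hω hω1 hρ₀ hnear hB hfirst hsmall
  rw [← outA_restrict S₀ M hMA hMB E₀ cB, ← outB_restrict S₀ M hMA hMB E₀ cB]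
  exact h

end OnSub

end Summit.QuantumFields.BalabanUV.T4Continuum.B13StepEndLoc

end
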